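import Literature.Computability.QuantumComplexity.ZWRing
import Literature.Barriers.QuantumAdvantage.BoundedEntanglementGram
import Literature.Barriers.QuantumAdvantage.BoundedEntanglementLocality
import HarnessLib

/-!
# Integral amplitudes of Clifford+`T` computations and integral Gram data

Topic `Literature/Barriers/QuantumAdvantage`; arithmetic file of the proof programme for the named
fact `Literature.Barriers.QuantumAdvantage.jozsaLinden2003_pblocked` (Jozsa–Linden 2003, §3).
With each Hadamard gate rescaled by `√2`, a Clifford+`T` circuit acts by matrices with entries in
`ℤ[ω]` (the coordinate model `ZW` of `QuantumComplexity/StateVectorDP.lean`, `ZWRing.lean`), so the rescaled state `√2^h |α_j⟩` (`h` = number of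
Hadamard gates among the first `j` gates) has coordinates in `ℤ[ω]`, and so do all the Gram data
`gram B (√2^h α_j)` (`BoundedEntanglementGram.lean`) that the simulation of lemma `ratpbl` stores
("assuming that the real numbers in (b) can each be described with `poly(m)` bits of memory";
here they are algebraic integers with four integer coordinates). This file provides the exact
integer-side objects and their evaluations:

* `gateZ op` — the rescaled gate matrices over `ZW` (`√2·H`, `S = diag(1, ω²)`, `T = diag(1, ω)`,
  `CNOT`), `zwVal_gateZ`;
* `applyZ`, `runZ` — the integral action of a placed gate / a gate list on coordinate vectors
  (`zwVal_applyZ`, `runZ_append_singleton`), started on `dpInit` (`zwVal_dpInit`). This is the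
  dense, `placeGate`-entry form of the dynamic programme `dpStep`/`dpRun` of `StateVectorDP.lean`
  (both compute `√2^h · U v` in `ℤ[ω]`-coordinates, hence the same table by `ZW.zwVal_injective`
  when the label list enumerates the register); it is chosen so that the Gram lemmas of
  `BoundedEntanglementGram.lean`, stated via `placeGate`/`Function.extend`, apply verbatim;
* `QCircuitFamily.ampZ F x j`, `QCircuitFamily.hExp F x j` — the integral amplitudes and the
  Hadamard count of the first `j` gates, with **`zwVal_ampZ`**:
  `zwVal (ampZ F x j y) = √2 ^ hExp F x j · stateAfter F x j y`;
* `gramZ` with `zwVal_gramZ` (integral Gram data evaluate to `gram`), and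
  `cnormSq_ampZ : ‖√2^h α_j‖² = 2^h` (the exact divisor of the merge step).

## References

* R. Jozsa, N. Linden, *On the role of entanglement in quantum-computational speed-up*, Proc. R.
  Soc. Lond. A 459 (2003) 2011–2032, arXiv:quant-ph/0201143: §3, lemma `ratlemma`, the remark
  following it, and the proof of lemma `ratpbl` ((b) block states; the update rule eq. (update)).
* M. A. Nielsen, I. L. Chuang, *Quantum Computation and Quantum Information*, CUP 2010, §4.2
  (the gates `H`, `S`, `T`, `CNOT`).
-/

noncomputable section

namespace Literature.Barriers.QuantumAdvantage

open Finset Matrix Literature.Computability.Cryptography Literature.Computability.QuantumComplexity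

variable {N : ℕ}

/-! ### Rescaled Clifford+`T` gates over `ℤ[ω]` -/

/-- The power of `√2` by which a gate symbol is rescaled: `1` for `H`, `0` otherwise. [cite: JozsaLinden2003, §3 (remark after lemma ratlemma)] -/
def sqrtTwoExp : CliffordTOp → ℕ
  | .H => 1
  | .S => 0
  | .T => 0
  | .CNOT => 0

/-- **The rescaled gate matrices over `ℤ[ω]`**: `√2·H = [[1, 1], [1, -1]]`, `S = diag(1, ω²)`,
`T = diag(1, ω)`, `CNOT` (a permutation matrix). [cite: NielsenChuang2010, §4.2] -/
def gateZ : (g : CliffordTOp) → Matrix (QReg (cliffordT.arity g)) (QReg (cliffordT.arity g)) ZW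
  | .H => Matrix.of fun (x y : QReg 1) => if x 0 = true ∧ y 0 = true then -ZW.one else ZW.one
  | .S => Matrix.of fun (x y : QReg 1) =>
      if x = y then (if x 0 = true then ZW.mulOmegaPow 2 ZW.one else ZW.one) else 0
  | .T => Matrix.of fun (x y : QReg 1) =>
      if x = y then (if x 0 = true then ZW.mulOmegaPow 1 ZW.one else ZW.one) else 0
  | .CNOT => Matrix.of fun (x y : QReg 2) => if x 0 = y 0 ∧ x 1 = (y 1 ^^ y 0) then ZW.one else 0

/-- `√2 · conj √2 = 2`, i.e. `|√2|² = 2`, in `ℂ`. [folklore] -/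
theorem sqrt_two_mul_conj_sqrt_two : (Real.sqrt 2 : ℂ) * starRingEnd ℂ (Real.sqrt 2 : ℂ) = 2 := by
  rw [Complex.conj_ofReal, ← Complex.ofReal_mul, Real.mul_self_sqrt zero_le_two]
  norm_num

/-- **The rescaled gates evaluate to `√2^{a} ·` the Clifford+`T` gates.** [cite: NielsenChuang2010, §4.2] -/
theorem zwVal_gateZ (g : CliffordTOp) (x y : QReg (cliffordT.arity g)) :
    ZW.zwVal (gateZ g x y) = (Real.sqrt 2 : ℂ) ^ sqrtTwoExp g * cliffordT.mat g x y := by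
  cases g with
  | H =>
    change ZW.zwVal (gateZ .H x y) = (Real.sqrt 2 : ℂ) ^ 1 * hGate x y
    simp only [gateZ, hGate, Matrix.of_apply, pow_one]
    split_ifs with h
    · rw [ZW.zwVal_neg, ZW.zwVal_one, mul_neg, ← invSqrt2, sqrt2_mul_invSqrt2]
    · rw [ZW.zwVal_one, ← invSqrt2, sqrt2_mul_invSqrt2]
  | S =>
    change ZW.zwVal (gateZ .S x y) = (Real.sqrt 2 : ℂ) ^ 0 * sGate x y
    simp only [gateZ, sGate, Matrix.of_apply, pow_zero, one_mul]
    split_ifs <;> simp [omega_pow_two]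
  | T =>
    change ZW.zwVal (gateZ .T x y) = (Real.sqrt 2 : ℂ) ^ 0 * tGate x y
    rw [tGate_eq_phaseGate]
    simp only [gateZ, phaseGate, Matrix.of_apply, pow_zero, one_mul]
    split_ifs <;> simp
  | CNOT =>
    change ZW.zwVal (gateZ .CNOT x y) = (Real.sqrt 2 : ℂ) ^ 0 * cnot x y
    simp only [gateZ, cnot, Matrix.of_apply, pow_zero, one_mul]
    split_ifs <;> simp

/-! ### The integral action of gates and gate lists -/

/-- The rescaling exponent of a placed gate (`1` for a Hadamard gate, `0` otherwise; oracle gates,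
absent from the families considered, get `0`). [folklore] -/
def qScale : QGate cliffordT N → ℕ
  | .gate op _ => sqrtTwoExp op
  | .oracle _ _ => 0

/-- `qScale` is the indicator of Hadamard gates, as counted by `hCount`. [folklore] -/
theorem qScale_eq_ite (g : QGate cliffordT N) : qScale g = if QGateIsH g then 1 else 0 := by
  rcases g with ⟨(_ | _ | _ | _), _⟩ | ⟨_, _⟩ <;> rfl

/-- **One rescaled gate on a coordinate vector**: `(applyZ g c) y = ∑_z gateZ (y|_E, z) · c (y[E ↦ z])`
(the update rule "`ã_{i₁i₂i₃…} = ∑ M^{j₁j₂}_{i₁i₂} a_{j₁j₂i₃…}`" in exact coordinates; oracle gates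
act as the identity). [cite: JozsaLinden2003, §3 (eq. (update))] -/
def applyZ : QGate cliffordT N → (QReg N → ZW) → (QReg N → ZW)
  | .gate op e, c => fun y =>
      ∑ z : QReg (cliffordT.arity op), ZW.mul (gateZ op (y ∘ e) z) (c (Function.extend e z y))
  | .oracle _ _, c => c

/-- **`applyZ` evaluates to the rescaled gate action**: if `zwVal ∘ c = v` then
`zwVal ((applyZ g c) y) = √2^{qScale g} · (U_g v) y` for an oracle-free gate `g`.
[cite: JozsaLinden2003, §3 (eq. (update))] -/
theorem zwVal_applyZ {g : QGate cliffordT N} (hg : g.IsOracleFree) {c : QReg N → ZW}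
    {v : QReg N → ℂ} (hcv : ∀ y, ZW.zwVal (c y) = v y) (y : QReg N) :
    ZW.zwVal (applyZ g c y) = (Real.sqrt 2 : ℂ) ^ qScale g * (g.toMatrix 0 *ᵥ v) y := by
  cases g with
  | oracle k e => exact absurd hg id
  | gate op e =>
    simp only [applyZ, qScale, QGate.toMatrix_gate]
    rw [placeGate_mulVec_apply, ZW.zwVal_sum, Finset.mul_sum]
    refine sum_congr rfl fun z _ => ?_
    rw [ZW.zwVal_mul, zwVal_gateZ, hcv]
    ring

/-- The integral action of a gate list (head acts first). [cite: JozsaLinden2003, §3 (the states |α_j⟩)] -/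
def runZ : List (QGate cliffordT N) → (QReg N → ZW) → (QReg N → ZW)
  | [], c => c
  | g :: gs, c => runZ gs (applyZ g c)

/-- Appending a gate applies it last. [folklore] -/
theorem runZ_append_singleton (gs : List (QGate cliffordT N)) (g : QGate cliffordT N)
    (c : QReg N → ZW) : runZ (gs ++ [g]) c = applyZ g (runZ gs c) := by
  induction gs generalizing c with
  | nil => rfl
  | cons g' gs ih => exact ih (applyZ g' c)

/-- The basis vector `|w⟩` in coordinates (`dpInit` of `StateVectorDP.lean`) evaluates to `basisState`.
[folklore] -/
theorem zwVal_dpInit (w y : QReg N) : ZW.zwVal (dpInit w y) = basisState w y := by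
  unfold dpInit
  rw [basisState_apply]
  split_ifs <;> simp

/-! ### Integral amplitudes of a circuit family -/

section Family

variable (F : QCircuitFamily cliffordT) (x : List Bool)

/-- **The integral amplitudes** of the family `F` on input `x` after `j` gates:
`runZ (first j gates) |x 0…0⟩` in `ℤ[ω]`-coordinates. Deliberate dot-notation extension of
`Literature.Computability.Cryptography.QCircuitFamily`. [cite: JozsaLinden2003, §3 (proof of lemma ratpbl, (b) block states)] -/
def _root_.Literature.Computability.Cryptography.QCircuitFamily.ampZ (j : ℕ) :
    QReg (x.length + F.ancillas x.length) → ZW :=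
  runZ ((F.circ x.length).gates.take j) (dpInit (padInput x.get (F.ancillas x.length)))

/-- **The Hadamard count** of the first `j` gates (the exponent `h` with `‖√2^h α_j‖² = 2^h`).
Deliberate dot-notation extension of `Literature.Computability.Cryptography.QCircuitFamily`. [folklore] -/
def _root_.Literature.Computability.Cryptography.QCircuitFamily.hExp (j : ℕ) : ℕ :=
  hCount ((F.circ x.length).gates.take j)

/-- Before any gate the integral amplitudes are the padded input basis vector. [folklore] -/
theorem ampZ_zero : F.ampZ x 0 = dpInit (padInput x.get (F.ancillas x.length)) := by
  simp [QCircuitFamily.ampZ, runZ]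

/-- One more gate: `ampZ (j+1) = applyZ g_j (ampZ j)` below the size. [folklore] -/
theorem ampZ_succ {j : ℕ} (hj : j < (F.circ x.length).gates.length) :
    F.ampZ x (j + 1) = applyZ ((F.circ x.length).gates[j]) (F.ampZ x j) := by
  simp only [QCircuitFamily.ampZ]
  rw [List.take_succ_eq_append_getElem hj, runZ_append_singleton]

/-- Beyond the size the integral amplitudes are final. [folklore] -/
theorem ampZ_of_length_le {j : ℕ} (hj : (F.circ x.length).gates.length ≤ j) :
    F.ampZ x j = F.ampZ x (F.circ x.length).gates.length := by
  simp only [QCircuitFamily.ampZ, List.take_of_length_le hj, List.take_length]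

/-- Hadamard count: none before the first gate. [folklore] -/
@[simp] theorem hExp_zero : F.hExp x 0 = 0 := by
  simp [QCircuitFamily.hExp]

/-- Hadamard count: one more gate. [folklore] -/
theorem hExp_succ {j : ℕ} (hj : j < (F.circ x.length).gates.length) :
    F.hExp x (j + 1) = F.hExp x j + qScale ((F.circ x.length).gates[j]) := by
  simp only [QCircuitFamily.hExp]
  rw [List.take_succ_eq_append_getElem hj, hCount, List.countP_append, qScale_eq_ite]
  simp [hCount, List.countP_cons]

/-- Hadamard count: constant beyond the size. [folklore] -/
theorem hExp_of_length_le {j : ℕ} (hj : (F.circ x.length).gates.length ≤ j) :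
    F.hExp x j = F.hExp x (F.circ x.length).gates.length := by
  simp only [QCircuitFamily.hExp, List.take_of_length_le hj, List.take_length]

/-- **The integral amplitudes are the rescaled states**: for an oracle-free family,
`zwVal (ampZ F x j y) = √2 ^ hExp F x j · stateAfter F x j y`.
[cite: JozsaLinden2003, §3 (proof of lemma ratpbl: the state description is updated at each step)] -/
theorem zwVal_ampZ (hF : F.IsOracleFree) (j : ℕ) (y : QReg (x.length + F.ancillas x.length)) :
    ZW.zwVal (F.ampZ x j y) = (Real.sqrt 2 : ℂ) ^ F.hExp x j * F.stateAfter x j y := by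
  induction j generalizing y with
  | zero => rw [ampZ_zero, hExp_zero, stateAfter_zero, zwVal_dpInit, pow_zero, one_mul]
  | succ j ih =>
    by_cases hj : j < (F.circ x.length).gates.length
    · rw [ampZ_succ F x hj, hExp_succ F x hj, stateAfter_succ F x hj,
        zwVal_applyZ (v := ((Real.sqrt 2 : ℂ) ^ F.hExp x j) • F.stateAfter x j)
          (hF x.length _ (List.getElem_mem hj)) (fun y => by rw [ih y, Pi.smul_apply, smul_eq_mul]),
        Matrix.mulVec_smul, Pi.smul_apply, smul_eq_mul, pow_add]
      ring
    · push Not at hj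
      rw [ampZ_of_length_le F x (Nat.le_succ_of_le hj), hExp_of_length_le F x (Nat.le_succ_of_le hj),
        stateAfter_of_length_le F x (Nat.le_succ_of_le hj), ← ampZ_of_length_le F x hj,
        ← hExp_of_length_le F x hj, ← stateAfter_of_length_le F x hj]
      exact ih y

/-- The rescaled state as a complex vector: `zwVal ∘ ampZ = √2^h • stateAfter`. [folklore] -/
theorem zwVal_comp_ampZ (hF : F.IsOracleFree) (j : ℕ) :
    (fun y => ZW.zwVal (F.ampZ x j y)) = ((Real.sqrt 2 : ℂ) ^ F.hExp x j) • F.stateAfter x j := by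
  funext y
  rw [zwVal_ampZ F x hF j y, Pi.smul_apply, smul_eq_mul]

end Family

/-! ### Integral Gram data -/

/-- **Integral Gram data**: `gramZ B c x y = ∑_{r ∈ cfg Bᶜ} c (x|_B, r) · cconj (c (y|_B, r))` in
`ℤ[ω]`-coordinates — the block data stored by the simulator. [cite: JozsaLinden2003, §3 (proof of lemma ratpbl, (b) block states; Case 2 reduced states)] -/
def gramZ (B : Finset (Fin N)) (c : QReg N → ZW) (x y : QReg N) : ZW :=
  ∑ r ∈ cfg Bᶜ, ZW.mul (c (B.piecewise x r)) (ZW.cconj (c (B.piecewise y r)))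

/-- **Integral Gram data evaluate to Gram data.** [cite: JozsaLinden2003, §3 (proof of lemma ratpbl, Case 2)] -/
theorem zwVal_gramZ (B : Finset (Fin N)) (c : QReg N → ZW) (x y : QReg N) :
    ZW.zwVal (gramZ B c x y) = gram B (fun w => ZW.zwVal (c w)) x y := by
  unfold gramZ gram
  rw [ZW.zwVal_sum]
  exact sum_congr rfl fun r _ => by rw [ZW.zwVal_mul, ZW.zwVal_cconj]

/-- The integral Gram data only see the `B`-parts of their arguments. [folklore] -/
theorem gramZ_congr {B : Finset (Fin N)} {c : QReg N → ZW} {x x' y y' : QReg N}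
    (hx : ∀ i ∈ B, x i = x' i) (hy : ∀ i ∈ B, y i = y' i) : gramZ B c x y = gramZ B c x' y' := by
  unfold gramZ
  refine sum_congr rfl fun r _ => ?_
  rw [B.piecewise_congr hx (fun _ _ => rfl), B.piecewise_congr hy (fun _ _ => rfl)]

/-- Scaling a vector scales its squared norm by the squared modulus. [folklore] -/
theorem cnormSq_smul (s : ℂ) (ψ : QReg N → ℂ) : cnormSq (s • ψ) = s * starRingEnd ℂ s * cnormSq ψ := by
  unfold cnormSq
  rw [Finset.mul_sum]
  exact sum_congr rfl fun w _ => by simp only [Pi.smul_apply, smul_eq_mul, map_mul]; ring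

/-- **`‖√2^h α_j‖² = 2^h`**: the squared norm of the integral amplitudes of a Clifford+`T` family
(the states `α_j` being unit vectors) — the exact divisor of the merge step.
[cite: JozsaLinden2003, §3 (proof of lemma ratpbl, Case 2)] -/
theorem cnormSq_ampZ (F : QCircuitFamily cliffordT) (hF : F.IsOracleFree) (x : List Bool) (j : ℕ) :
    cnormSq (fun y => ZW.zwVal (F.ampZ x j y)) = (2 : ℂ) ^ F.hExp x j := by
  rw [zwVal_comp_ampZ F x hF j, cnormSq_smul, cnormSq_eq_normSq, normSq_stateAfter_cliffordT,
    map_pow, ← mul_pow, sqrt_two_mul_conj_sqrt_two]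
  simp

end Literature.Barriers.QuantumAdvantage

end
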